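import Mathlib
import HarnessLib

/-!
# R90-TF · S6 «Ch. 14.1–14.5 stable trace formula» — WAVE 2, W2-b: CHART PACKAGING OF AN ABSOLUTELY CONTINUOUS SPECTRAL TERM
# (`chartPushforward_ac`: an atomless source with an `L¹` density, pushed along a measurable embedding into the compact chart
# `X ⊂ ℂ`, is again «atomless measure × L¹ density» — the `HeckeContinuous` shape of FILE B)

Cell `hodgecm-mathlib`, crux H413 (`stmt-HodgeConjecture-24833`), route of record `HCCMUnconditional`; programme R90-TF (brief
`director/R90-BRIEF.v2.md` 1f40d54518340a35), section S6 = Ch. 14.1–14.5 (base `R90-C14`), seat R90-C14-p04 (g0); dealt BY NAME by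
the section planner `R90-C14-plan (g0)` (S6 WAVE 2 DEAL, R90 bus 15:53:05Z): W2-b of the target sheet
`R90/R90-C14-plan/g0/S6_wave2_targets.v1.R90-C14-plan-g0.lean` (sha16 ea7d8b634ac71f5c, :32–:38, signature VERBATIM, namespace segment
`.Wave2` dropped as dealt).  A supply-side helper for the ED. 2b suppliers of the S6 engine's hypothesis `HeckeDichotomyOv` (Lines file
`Cruxes/H413/Lines/R90_S6_StableTFSpectralB.lean` §E1 ∕ §E6): its conclusion is the EXPANDED body of B's `HeckeContinuous X ev R` shape
«`∃ (m : Measure X) (d : X → ℂ), (∀ x, m {x} = 0) ∧ Integrable d m ∧ …`» (gate `lint.import`: a Theorems file may not import a Lines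
module; junction by name-shape as for W1-d ★ `R90S6LanglandsDichotomy`).  Helper file, lane `--supports stmt-HodgeConjecture-24833`;
ONE theorem, pure Mathlib, no definition, no instance, no notation, no `sorry`.  HONEST LABEL: HC_CM is proved only modulo the 7
printed citations (2 remaining named inputs: hLiu418 = stmt-HodgeConjecture-24832, h413 = stmt-HodgeConjecture-24833) until rung 0
closes; this file is generic measure theory and proves no printed global statement by itself.

THE MATHEMATICS [Rogawski1990 §10.3 p. 159: «(10.3.2) and (10.3.3) extend to linear functionals on C … an absolutely continuous
measure on X»; §2.3 (2.3.4) p. 18 (Arthur's continuous `M`-terms are integrals over unitary characters of `M` against measures with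
`L¹` densities); §14.5 p. 241].  The continuous spectral terms are produced on their own parameter space `Y` (unitary characters of
`M`, a circle ∕ line with an atomless finite measure `μ` and an `L¹` density `d`); the dichotomy text `HeckeContinuous` wants them on
the compact Satake chart `X ⊂ ℂ` (the `t = z + z⁻¹` image, p. 159).  If `t : Y → X` is a measurable embedding, put `m := t_* μ`
(`Measure.map`) and `d' := ` the extension of `d` along `t` by `0` (`Function.extend t d 0`, well defined by injectivity).  Then
(i) `m {x} = μ (t⁻¹ {x}) = 0`, because `t⁻¹ {x}` is empty or a singleton (`t` injective) and `μ` has no atoms;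
(ii) `d' ∈ L¹(m)` since `d' ∘ t = d ∈ L¹(μ)` (`MeasurableEmbedding.integrable_map_iff`);
(iii) `∫_Y g(t y) d(y) dμ = ∫_X g(x) d'(x) dm` for every `g ∈ C(X, ℂ)` (change of variables `MeasurableEmbedding.integral_map` and
`d'(t y) = d(y)`).

## References
* [Rogawski1990] J. D. Rogawski, *Automorphic Representations of Unitary Groups in Three Variables*, Ann. of Math. Stud. 123
  (1990): §10.3 p. 159 ((10.3.2)–(10.3.3), proof of Thm. 10.3.1); §2.3 (2.3.4) p. 18; §14.5 pp. 240–241.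
-/

set_option autoImplicit false
-- the mandated namespace repeats the single-problem summit's segment (`HodgeConjecture.HodgeConjecture`)
set_option linter.dupNamespace false

noncomputable section

open MeasureTheory

namespace Summit.HodgeConjecture.HodgeConjecture.R90.S6

/-- **W2-b · chart packaging of an absolutely continuous functional** [Rogawski1990 §10.3 p. 159 ((10.3.2)–(10.3.3): «extend to
linear functionals on C … an absolutely continuous measure on X»); §2.3 (2.3.4) p. 18; §14.5 p. 241]: let `X ⊂ ℂ` be compact, `(Y, μ)`
a finite measure space without atoms (`μ {y} = 0` for all `y`), `d ∈ L¹(μ)` and `t : Y → X` a measurable embedding.  Then there are a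
measure `m` on `X` without atoms and a density `d' ∈ L¹(m)` with `∫ g(t y) · d(y) dμ(y) = ∫ g(x) · d'(x) dm(x)` for every
`g ∈ C(X, ℂ)` — namely `m := t_* μ` and `d' := d` extended by `0` off the range of `t`.  (Signature verbatim from the S6 WAVE 2 sheet,
W2-b; conclusion = the expanded `HeckeContinuous` shape of `R90_S6_StableTFSpectralB` §E1 for the functional `g ↦ ∫ g ∘ t · d dμ`.) -/
theorem chartPushforward_ac (X : TopologicalSpace.Compacts ℂ) {Y : Type*} [MeasurableSpace Y] [MeasurableSingletonClass Y]
    (μ : Measure Y) [IsFiniteMeasure μ] (hμ : ∀ y : Y, μ {y} = 0) (d : Y → ℂ) (hd : Integrable d μ)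
    (t : Y → X) (ht : MeasurableEmbedding t) :
    ∃ (m : Measure X) (d' : X → ℂ), (∀ x : X, m {x} = 0) ∧ Integrable d' m ∧
      ∀ g : C(X, ℂ), ∫ y, g (t y) * d y ∂μ = ∫ x, g x * d' x ∂m := by
  -- the extension of `d` along `t` by `0` restricts back to `d`
  have hext : ∀ y : Y, Function.extend t d 0 (t y) = d y := fun y => ht.injective.extend_apply d 0 y
  refine ⟨μ.map t, Function.extend t d 0, fun x => ?_, ?_, fun g => ?_⟩
  · -- (i) `t_* μ` has no atoms: `t ⁻¹' {x}` is empty or a singleton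
    rw [ht.map_apply]
    rcases (Set.subsingleton_singleton.preimage ht.injective : (t ⁻¹' {x}).Subsingleton).eq_empty_or_singleton with h | ⟨y, hy⟩
    · rw [h, measure_empty]
    · rw [hy, hμ y]
  · -- (ii) the extended density is `L¹(t_* μ)` because it pulls back to `d`
    rw [ht.integrable_map_iff]
    have hcomp : (Function.extend t d 0 ∘ t) = d := funext fun y => hext y
    rw [hcomp]
    exact hd
  · -- (iii) change of variables along the embedding
    rw [ht.integral_map]
    refine integral_congr_ae (Filter.Eventually.of_forall fun y => ?_)
    simp only [hext]

end Summit.HodgeConjecture.HodgeConjecture.R90.S6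

end
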